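import Mathlib
import Literature.NumberTheory.LFunctions.WeilMarkovQuadratic
import HarnessLib

/-!
# Window bookkeeping on the first-prime range `(log 2)/2 < b ≤ (log 3)/2`

Stub `stub_markovFirstPrime` for the line *parity–multiplicity–commutator* of the crux
`GroundStateSimpleEven` (Weil ground state). In the Markov decomposition
`Re Q(g) = P(g) + 𝓔_b(g) − M_b ‖g‖₂²` of Weil's quadratic functional on a window `[-b, b]`
(`Literature/NumberTheory/LFunctions/WeilMarkovQuadratic.lean`) the prime powers that enter are
indexed by `weilPrimeIndex b = {n ≤ ⌊e^{2b}⌋ : log n < 2b}`. On the first-prime range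
`(log 2)/2 < b ≤ (log 3)/2` this index set consists of `n ∈ {0, 1, 2}` (`log n < 2b ≤ log 3` forces
`n < 3`), the summands at `n = 0, 1` vanish (`Λ 0 = Λ 1 = 0`), and `2 ∈ weilPrimeIndex b` with
`Λ(2) 2^{-1/2} = log 2/√2`. Hence

* `M_b = 2 (log 2/√2) + 2 ∫₀^∞ (e^{t/2} − 1)/(2 sinh t) dt + log 4π + γ`,
* `𝓔_b(g) = (log 2/√2) D_{log 2}(g) + ∫_{(0,∞)} ρ(t) D_t(g) dt`.

Template: `par_weilMarkovConstant_eq` (…StubParabolaRayleigh.lean). Mathlib + the proved tree file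
`WeilMarkovQuadratic` only; no definitions, no named facts, no `sorry`.
-/

open Set MeasureTheory Filter

open scoped Real Topology

open Literature.NumberTheory.LFunctions

namespace Summit.RiemannHypothesis.RiemannHypothesis.Theorems

namespace GroundStateSimpleEven

set_option linter.dupNamespace false in
/-- The prime `2` enters every window beyond the first prime: `2 ∈ weilPrimeIndex b` for
`(log 2)/2 < b`. [folklore] -/
theorem mkfp_two_mem_weilPrimeIndex {b : ℝ} (hb : Real.log 2 / 2 < b) :
    2 ∈ weilPrimeIndex b := by
  rw [mem_weilPrimeIndex]
  push_cast
  linarith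

set_option linter.dupNamespace false in
/-- Below the second prime only `n = 2` carries von Mangoldt weight: for `b ≤ (log 3)/2`,
`n ∈ weilPrimeIndex b` and `n ≠ 2` give `Λ(n) = 0` (`log n < 2b ≤ log 3` forces `n ≤ 2`, and
`Λ 0 = Λ 1 = 0`). [folklore] -/
theorem mkfp_vonMangoldt_eq_zero {b : ℝ} (hb : b ≤ Real.log 3 / 2) {n : ℕ}
    (hn : n ∈ weilPrimeIndex b) (h2 : n ≠ 2) : (ArithmeticFunction.vonMangoldt n : ℝ) = 0 := by
  rw [mem_weilPrimeIndex] at hn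
  rcases Nat.lt_or_ge n 3 with h3 | h3
  · interval_cases n
    · simp
    · simp
    · exact absurd rfl h2
  · exfalso
    have hlog : Real.log 3 ≤ Real.log n :=
      Real.log_le_log three_pos (by exact_mod_cast h3)
    linarith

set_option linter.dupNamespace false in
/-- On the first-prime range the prime sum of the window collapses to its `n = 2` term:
`Σ_{n ∈ weilPrimeIndex b} Λ(n) n^{-1/2} F(n) = (log 2/√2) F(2)` for
`(log 2)/2 < b ≤ (log 3)/2`. [folklore] -/
theorem mkfp_sum_eq {b : ℝ} (hb : Real.log 2 / 2 < b) (hb3 : b ≤ Real.log 3 / 2) (F : ℕ → ℝ) :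
    ∑ n ∈ weilPrimeIndex b, (ArithmeticFunction.vonMangoldt n : ℝ) / Real.sqrt n * F n =
      Real.log 2 / Real.sqrt 2 * F 2 := by
  rw [Finset.sum_eq_single_of_mem 2 (mkfp_two_mem_weilPrimeIndex hb) fun n hn hne ↦ by
    rw [mkfp_vonMangoldt_eq_zero hb3 hn hne, zero_div, zero_mul],
    ArithmeticFunction.vonMangoldt_apply_prime Nat.prime_two]
  push_cast
  rfl

end GroundStateSimpleEven

set_option linter.dupNamespace false in
/-- **Window bookkeeping on the first-prime range.** For `(log 2)/2 < b ≤ (log 3)/2` exactly one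
prime power enters the window `[-b, b]`: `weilPrimeIndex b` carries `Λ(n) n^{-1/2} = 0` except at
`n = 2`, where it is `log 2/√2`. Hence the killing constant is
`M_b = 2 (log 2/√2) + 2 ∫₀^∞ (e^{t/2} − 1)/(2 sinh t) dt + log 4π + γ` and the Dirichlet energy is
`𝓔_b(g) = (log 2/√2) D_{log 2}(g) + ∫_{(0,∞)} ρ D_t(g)`. [folklore] -/
theorem stub_markovFirstPrime :
    ∀ b : ℝ, Real.log 2 / 2 < b → b ≤ Real.log 3 / 2 →
      weilMarkovConstant b =
          2 * (Real.log 2 / Real.sqrt 2) +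
            2 * (∫ t in Ioi (0 : ℝ), (Real.exp (t / 2) - 1) / (2 * Real.sinh t)) +
            (Real.log (4 * Real.pi) + Real.eulerMascheroniConstant) ∧
      ∀ g : ℝ → ℂ, weilDirichletEnergy b g =
          Real.log 2 / Real.sqrt 2 * weilIncrement g (Real.log 2) +
            ∫ t in Ioi (0 : ℝ), weilArchDensity t * weilIncrement g t := by
  intro b hb hb3
  refine ⟨?_, fun g ↦ ?_⟩
  · have h := GroundStateSimpleEven.mkfp_sum_eq hb hb3 fun _ ↦ 1
    simp only [mul_one] at h
    unfold weilMarkovConstant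
    rw [h]
  · unfold weilDirichletEnergy
    rw [GroundStateSimpleEven.mkfp_sum_eq hb hb3 fun n ↦ weilIncrement g (Real.log n)]
    push_cast
    rfl

end Summit.RiemannHypothesis.RiemannHypothesis.Theorems
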